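import Literature.Topology.FourManifolds.HomotopySpheresBPOrderProofs
import Literature.Topology.FourManifolds.WhitneySphereEmbeddingProofs
import Literature.Topology.FourManifolds.HomotopySpheresSignatureProofs
import Literature.AlgebraicTopology.SingularHomology.PoincareDualityProofs
import Literature.AlgebraicTopology.SingularHomology.UniversalCoefficientsProofs
import Literature.AlgebraicTopology.SingularHomology.CupProductProofs
import Literature.AlgebraicTopology.SingularHomology.CohomologyFiniteness
import Literature.Topology.FourManifolds.LatticeFormsVanDerBlij
import Literature.AlgebraicTopology.Homotopy.WhiteheadTheoremProofs
import Literature.AlgebraicTopology.Homotopy.CompactManifoldCWTypeProofs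
import HarnessLib

/-!
# `|Θ₇| = 28` and `|bP₈| = 28`: the assembly over the current frontier of named facts

Topic `Literature/Topology/FourManifolds`; pure-proof companion of `HCobordism.lean`
(`Literature.Topology.FourManifolds.natCard_homotopySphereClass_seven`, **spc4.S13**:
`Nat.card (HomotopySphereClass 7) = 28`, Kervaire–Milnor, *Groups of homotopy spheres I*, Ann. of
Math. 77 (1963), Thm. 1.2 and table p. 504; Kosinski, *Differential Manifolds* (1993), Ch. X §6,
p. 219: "`θ⁷ = ℤ₂₈`") and of `HomotopySpheresBPOrder.lean` (`HomotopySphereClass.natCard_bP_seven`,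
`|bP₈| = 28`, Kosinski X §6, Prop. 6.2(a) and p. 217). Everything here is **proved**; no
definition, no new named fact, no statement is changed.

`HomotopySpheresBPOrderProofs.lean` proves the assembly
`natCard_homotopySphereClass_seven_of_leaves'''` of `|Θ₇| = 28` from `23` named facts of the tree
(and `HomotopySphereClass.natCard_bP_seven_of_leaves`, `|bP₈| = 28` from `18` of them). Ten of
those leaves have since been DISCHARGED unconditionally elsewhere in the tree, in files which
`HomotopySpheresBPOrderProofs.lean` cannot import without cycles or which postdate it:

* Kervaire–Milnor's Lemma 3.3 (normal framings of s-parallelizable submanifolds of large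
  codimension): `exists_isNormalFraming_of_isStablyParallelizable_holds`
  (`WhitneySphereEmbeddingProofs.lean`);
* the comparison "a signature in `signatureSet` makes the sphere bound a parallelizable manifold"
  (§7 with Lemma 3.4): `HomotopySphere.boundsParallelizable_of_mem_signatureSet_holds`
  (`HomotopySpheresSignatureProofs.lean`);
* Poincaré duality (Hatcher Thm. 3.30): `Literature.AlgebraicTopology.SingularHomology.poincare_duality`
  (`PoincareDualityProofs.lean`);
* both universal-coefficient clauses (Hatcher Thm. 3.2: the Kronecker map is onto with torsion
  kernel): `kroneckerMap_surjective_holds`, `ker_kroneckerMap_le_torsion_holds`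
  (`UniversalCoefficientsProofs.lean`);
* finiteness of the cohomology of closed topological manifolds over `ℤ` (Hatcher Cor. A.8–A.9):
  `finite_singularCohomology_of_compactSpace_of_isPrincipalIdealRing` (`CohomologyFiniteness.lean`);
* graded commutativity of the cup product (Hatcher Thm. 3.11): `cupProduct_gradedComm_holds`
  (`CupProductProofs.lean`);
* van der Blij's lemma (Serre, *Cours d'arithmétique*, V §2.1, Thm. 2, Cor. 1):
  `LinearMap.BilinForm.eight_dvd_signature_of_isEven_holds` (`LatticeFormsVanDerBlij.lean`);
* Whitehead's theorem (Hatcher Cor. 4.33): `whitehead_exists_homotopyEquiv_holds`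
  (`WhiteheadTheoremProofs.lean`);
* the CW homotopy type of compact manifolds (Hatcher Cor. A.12):
  `exists_cwComplex_homotopyEquiv_of_compactSpace_holds` (`CompactManifoldCWTypeProofs.lean`).

Feeding these discharges into the two assemblies leaves the **current frontier**:

* `HomotopySphereClass.natCard_bP_seven_of_frontier` — `|bP₈| = 28` from `9` named facts:
  Thm. 7.5 (`HomotopySphere.mk_eq_mk_iff_sigmaGen_dvd_sub`); the comparison
  `HomotopySphere.nonempty_signatureSet_of_boundsParallelizable` (§4/§7); Kosinski X.2.2/X.3.3
  (highly connected representatives, `HomotopySphere.exists_highlyConnected_of_mem_signatureSet`)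
  and X.3.1 (evenness, `HomotopySphere.isEven_intersectionForm_closedModel`); Milnor's
  `E₈`-plumbing (Kosinski VI.12 with IX.7.5, `HomotopySphere.exists_intersectionForm_equivalent_e8Form`);
  Milnor's Prop. B (smooth simply connected homology spheres of dimension `≥ 5` are topological
  spheres, `nonempty_homeomorph_sphere_of_homologySphere_of_five_le`); additivity of the
  signature over sums along the boundary
  (`HomotopySphere.add_mem_signatureSet_of_isOrientedConnectedSum`); and the two halves of
  `σ₂ = 224` (`HomotopySphere.twoHundredTwentyFour_dvd_of_mem_signatureSet_sphere`,
  `HomotopySphere.exists_twoHundredTwentyFour_mem_signatureSet_sphere`).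
* `natCard_homotopySphereClass_seven_of_frontier` — `|Θ₇| = 28` from those `9` and the `4`
  serving `Θ₇ = bP₈` (Kervaire–Milnor Thm. 3.1 at `n = 7` and §4): Bott's `π₆(SO) = 0` in
  extension form (`Bott1959_sphereMapsToStableFramesExtend_six`), "`o₇` is the only obstruction"
  (`HomotopySphere.hasStableTangentFramingAlong_compl_singleton`), Lemma 4.2
  (`boundsParallelizable_of_collapseNullHomotopic`) and `coker J₇ = 0`
  (`HomotopySphere.exists_collapseNullHomotopic_seven`).

So the discharge `natCard_homotopySphereClass_seven_holds` is exactly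
`natCard_homotopySphereClass_seven_of_frontier` applied to the `_holds` of these `13` facts, once
they exist; no further decomposition of spc4.S13 is needed or intended.

## References

* M. Kervaire, J. Milnor, *Groups of homotopy spheres I*, Ann. of Math. 77 (1963): Thm. 1.2,
  table p. 504 (`Θ₇ : 28`), Thm. 3.1, §4 (Lemmas 3.3, 4.2, 4.5), §7 (Thm. 7.5, Cor. 7.6,
  pp. 528–531). [KervaireMilnorAnnals1963]
* A. Kosinski, *Differential Manifolds* (1993), VIII §5 (5.5)–(5.6) (`θᵐ`), Ch. X §6,
  Prop. 6.2(a), p. 217 (`bP⁸ = ℤ₂₈`) and p. 219 (`θ⁷ = ℤ₂₈`). [Kosinski1993]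
* A. Hatcher, *Algebraic Topology* (2002), Thm. 3.2, Thm. 3.11, Thm. 3.30, Cor. 4.33, Cor. A.8–A.9,
  Cor. A.12. [HatcherAT2002]
* J. Milnor, *Lectures on the h-cobordism theorem* (1965), §9, Prop. B and Corollary (p. 109).
  [MilnorHCobordism1965]
* J.-P. Serre, *A Course in Arithmetic* (1973), Ch. V §2.1, Thm. 2, Cor. 1. [Serre1973]
-/

open scoped Manifold ContDiff Topology

noncomputable section

namespace Literature.Topology.FourManifolds

namespace HomotopySphereClass

/-- **`|bP₈| = 28` over the current frontier of named facts (`9` leaves).** The assembly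
`HomotopySphereClass.natCard_bP_seven_of_leaves` (`HomotopySpheresBPOrderProofs.lean`, `18`
leaves) with its nine discharged leaves fed their tree proofs: the comparison
`HomotopySphere.boundsParallelizable_of_mem_signatureSet_holds`, Poincaré duality
(`poincare_duality`), the two universal-coefficient clauses (`kroneckerMap_surjective_holds`,
`ker_kroneckerMap_le_torsion_holds`), finiteness of `Hⁱ(X; ℤ)` for closed topological manifolds
(`finite_singularCohomology_of_compactSpace_of_isPrincipalIdealRing`), graded commutativity
(`cupProduct_gradedComm_holds`), van der Blij's lemma (`eight_dvd_signature_of_isEven_holds`),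
Whitehead's theorem (`whitehead_exists_homotopyEquiv_holds`) and the CW type of compact manifolds
(`exists_cwComplex_homotopyEquiv_of_compactSpace_holds`). What remains: Kervaire–Milnor's
Thm. 7.5, the comparison `bP₈ →` oriented s-parallelizable null-cobordisms, Kosinski's X.2.2/X.3.3
and X.3.1, the `E₈`-plumbing, Milnor's Prop. B, additivity of `σ`, and the two halves of
`σ₂ = 224`. Kervaire–Milnor 1963, §7 (Thm. 7.5, Cor. 7.6, pp. 528–531); Kosinski 1993, Ch. X §6,
Prop. 6.2(a) and p. 217 ("Since `t₂/8 = 28`, it follows that `bP⁸ = ℤ₂₈`"). [cite: KervaireMilnorAnnals1963, §7, Thm. 7.5, Cor. 7.6 and pp. 528–531] [cite: Kosinski1993, Ch. X §6, Prop. 6.2(a) and p. 217 (bP⁸ = ℤ₂₈)] -/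
theorem natCard_bP_seven_of_frontier
    (h75 : HomotopySphere.mk_eq_mk_iff_sigmaGen_dvd_sub)
    (hne : HomotopySphere.nonempty_signatureSet_of_boundsParallelizable)
    (hconn : HomotopySphere.exists_highlyConnected_of_mem_signatureSet)
    (heven : HomotopySphere.isEven_intersectionForm_closedModel)
    (hΓ : HomotopySphere.exists_intersectionForm_equivalent_e8Form)
    (hPB : nonempty_homeomorph_sphere_of_homologySphere_of_five_le.{0})
    (hadd : HomotopySphere.add_mem_signatureSet_of_isOrientedConnectedSum)
    (hdvd : HomotopySphere.twoHundredTwentyFour_dvd_of_mem_signatureSet_sphere)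
    (hex : HomotopySphere.exists_twoHundredTwentyFour_mem_signatureSet_sphere) :
    natCard_bP_seven :=
  natCard_bP_seven_of_leaves h75 hne
    HomotopySphere.boundsParallelizable_of_mem_signatureSet_holds hconn heven
    (fun _ _ _ _ _ _ μ _ _ hpq =>
      Literature.AlgebraicTopology.SingularHomology.poincare_duality μ hpq)
    (fun X _ q =>
      Literature.AlgebraicTopology.SingularHomology.kroneckerMap_surjective_holds ℤ X q)
    (fun X _ q =>
      @Literature.AlgebraicTopology.SingularHomology.ker_kroneckerMap_le_torsion_holds ℤ _ _ _ X _ q)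
    (fun X _ _ _ k _ i =>
      Literature.AlgebraicTopology.SingularHomology.finite_singularCohomology_of_compactSpace_of_isPrincipalIdealRing
        ℤ X k i)
    (fun X _ => Literature.AlgebraicTopology.SingularHomology.cupProduct_gradedComm_holds ℤ X)
    (fun _ _ _ Q => Q.eight_dvd_signature_of_isEven_holds)
    hΓ hPB hadd
    Literature.AlgebraicTopology.Homotopy.whitehead_exists_homotopyEquiv_holds.{0}
    Literature.AlgebraicTopology.Homotopy.exists_cwComplex_homotopyEquiv_of_compactSpace_holds.{0}
    hdvd hex

end HomotopySphereClass

/-- **`|Θ₇| = 28` over the current frontier of named facts (`13` leaves).** The assembly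
`natCard_homotopySphereClass_seven_of_leaves'''` (`HomotopySpheresBPOrderProofs.lean`, `23`
leaves) with its ten discharged leaves fed their tree proofs: Kervaire–Milnor's Lemma 3.3
(`exists_isNormalFraming_of_isStablyParallelizable_holds`), the comparison
`HomotopySphere.boundsParallelizable_of_mem_signatureSet_holds`, Poincaré duality
(`poincare_duality`), the two universal-coefficient clauses (`kroneckerMap_surjective_holds`,
`ker_kroneckerMap_le_torsion_holds`), finiteness of `Hⁱ(X; ℤ)`
(`finite_singularCohomology_of_compactSpace_of_isPrincipalIdealRing`), graded commutativity
(`cupProduct_gradedComm_holds`), van der Blij's lemma (`eight_dvd_signature_of_isEven_holds`),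
Whitehead's theorem (`whitehead_exists_homotopyEquiv_holds`) and the CW type of compact manifolds
(`exists_cwComplex_homotopyEquiv_of_compactSpace_holds`). What remains are `13` named facts:
Bott's `π₆(SO) = 0` in extension form and "`o₇` is the only obstruction" (Thm. 3.1 at `n = 7`),
Lemma 4.2 and `coker J₇ = 0` (§4: together `Θ₇ = bP₈`), and the nine leaves of
`HomotopySphereClass.natCard_bP_seven_of_frontier` (`|bP₈| = 28`). The target is spc4.S13,
`Literature.Topology.FourManifolds.natCard_homotopySphereClass_seven`: Kervaire–Milnor 1963,
Thm. 1.2 and table p. 504 (`Θ₇ : 28`); Kosinski 1993, Ch. X §6, p. 219 ("`θ⁷ = ℤ₂₈`"), where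
`θ⁷` is the group of h-cobordism classes of homotopy `7`-spheres, identified with the oriented
diffeomorphism classes for `m ≥ 5` (VIII (5.5)–(5.6)). [cite: KervaireMilnorAnnals1963, Thm. 1.2 and table p. 504; Thm. 3.1, §4 (Lemmas 3.3, 4.2, 4.5), §7 (Thm. 7.5, pp. 528–531)] [cite: Kosinski1993, Ch. X §6, p. 219 (θ⁷ = ℤ₂₈), with VIII (5.5)–(5.6) and Prop. 6.2(a)] -/
theorem natCard_homotopySphereClass_seven_of_frontier
    (hB : Bott1959_sphereMapsToStableFramesExtend_six)
    (hAP : HomotopySphere.hasStableTangentFramingAlong_compl_singleton)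
    (h42 : boundsParallelizable_of_collapseNullHomotopic)
    (hJ : HomotopySphere.exists_collapseNullHomotopic_seven)
    (h75 : HomotopySphere.mk_eq_mk_iff_sigmaGen_dvd_sub)
    (hne : HomotopySphere.nonempty_signatureSet_of_boundsParallelizable)
    (hconn : HomotopySphere.exists_highlyConnected_of_mem_signatureSet)
    (heven : HomotopySphere.isEven_intersectionForm_closedModel)
    (hΓ : HomotopySphere.exists_intersectionForm_equivalent_e8Form)
    (hPB : nonempty_homeomorph_sphere_of_homologySphere_of_five_le.{0})
    (hadd : HomotopySphere.add_mem_signatureSet_of_isOrientedConnectedSum)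
    (hdvd : HomotopySphere.twoHundredTwentyFour_dvd_of_mem_signatureSet_sphere)
    (hex : HomotopySphere.exists_twoHundredTwentyFour_mem_signatureSet_sphere) :
    natCard_homotopySphereClass_seven :=
  natCard_homotopySphereClass_seven_of_leaves''' hB hAP
    exists_isNormalFraming_of_isStablyParallelizable_holds h42 hJ h75 hne
    HomotopySphere.boundsParallelizable_of_mem_signatureSet_holds hconn heven
    (fun _ _ _ _ _ _ μ _ _ hpq =>
      Literature.AlgebraicTopology.SingularHomology.poincare_duality μ hpq)
    (fun X _ q =>
      Literature.AlgebraicTopology.SingularHomology.kroneckerMap_surjective_holds ℤ X q)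
    (fun X _ q =>
      @Literature.AlgebraicTopology.SingularHomology.ker_kroneckerMap_le_torsion_holds ℤ _ _ _ X _ q)
    (fun X _ _ _ k _ i =>
      Literature.AlgebraicTopology.SingularHomology.finite_singularCohomology_of_compactSpace_of_isPrincipalIdealRing
        ℤ X k i)
    (fun X _ => Literature.AlgebraicTopology.SingularHomology.cupProduct_gradedComm_holds ℤ X)
    (fun _ _ _ Q => Q.eight_dvd_signature_of_isEven_holds)
    hΓ hPB hadd
    Literature.AlgebraicTopology.Homotopy.whitehead_exists_homotopyEquiv_holds.{0}
    Literature.AlgebraicTopology.Homotopy.exists_cwComplex_homotopyEquiv_of_compactSpace_holds.{0}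
    hdvd hex

/-- **`Θ₇ ≅ ℤ₂₈` over the current frontier**, granted the cyclicity fact
`Literature.Topology.FourManifolds.exists_commGroup_homotopySphereClass_isCyclic_seven` of
`HCobordism.lean`: the group structure on `Θ₇` whose multiplication is the connected sum is
isomorphic to `ℤ/28` (`exists_commGroup_mulEquiv_zmod_of`, `HomotopySpheresBPOrder.lean`, with
`natCard_homotopySphereClass_seven_of_frontier`). Kervaire–Milnor 1963, Thm. 1.1 and table
p. 504; Kosinski 1993, Ch. X §6, p. 219. [cite: KervaireMilnorAnnals1963, Thm. 1.1–1.2 and table p. 504] [cite: Kosinski1993, Ch. X §6, p. 219 (θ⁷ = ℤ₂₈)] -/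
theorem exists_commGroup_mulEquiv_zmod_of_frontier
    (h₀ : exists_commGroup_homotopySphereClass_isCyclic_seven)
    (hB : Bott1959_sphereMapsToStableFramesExtend_six)
    (hAP : HomotopySphere.hasStableTangentFramingAlong_compl_singleton)
    (h42 : boundsParallelizable_of_collapseNullHomotopic)
    (hJ : HomotopySphere.exists_collapseNullHomotopic_seven)
    (h75 : HomotopySphere.mk_eq_mk_iff_sigmaGen_dvd_sub)
    (hne : HomotopySphere.nonempty_signatureSet_of_boundsParallelizable)
    (hconn : HomotopySphere.exists_highlyConnected_of_mem_signatureSet)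
    (heven : HomotopySphere.isEven_intersectionForm_closedModel)
    (hΓ : HomotopySphere.exists_intersectionForm_equivalent_e8Form)
    (hPB : nonempty_homeomorph_sphere_of_homologySphere_of_five_le.{0})
    (hadd : HomotopySphere.add_mem_signatureSet_of_isOrientedConnectedSum)
    (hdvd : HomotopySphere.twoHundredTwentyFour_dvd_of_mem_signatureSet_sphere)
    (hex : HomotopySphere.exists_twoHundredTwentyFour_mem_signatureSet_sphere) :
    ∃ _ : CommGroup (HomotopySphereClass 7),
      (∀ a b c : HomotopySphereClass 7, HomotopySphereClass.IsMul a b c → a * b = c) ∧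
        Nonempty (HomotopySphereClass 7 ≃* Multiplicative (ZMod 28)) :=
  exists_commGroup_mulEquiv_zmod_of h₀
    (natCard_homotopySphereClass_seven_of_frontier hB hAP h42 hJ h75 hne hconn heven hΓ hPB hadd
      hdvd hex)

end Literature.Topology.FourManifolds
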